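import Summits.CriticalPhenomena.PercolationContinuityZ3.Theorems.PercNearOneGluingNoHeavyLowerTailCSHDefs
import Literature.Probability.Percolation.ConditionalPositiveAssociationProofs
import Literature.Probability.Percolation.TwoClusterConditionalAssociation
import Literature.Probability.Percolation.KozmaNitzanSeparatingTriple
import HarnessLib

/-!
# Single-edge extremality holds against every competitor SATURATED on `{v ∈ C_x}` (PAPER-2 track (ii): constants of the CSH family)

builds on p205010 (kernel theorem, internal audit signed; external expert review pending).  Support file (`--supports
stmt-CriticalPhenomena-4575`), seat `prim-consts-2`; rows A6/A11 of `run/shared/lean/prim/consts/CONSTANTS.md`, prim-paper-s3 F7.  No definitions,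
no named facts, no sorries.  Companion of `…ConstsSingleEdgeVClass` (competitors SUPPORTED on `{v ∈ C_x}`).

Level `0` of the conditioned slack hierarchy (MDL(X)): `covD w x Y f o ≥ λ · covD w x Y f v` for monotone `f` of the open edge cluster of `x`.
The conjecture "single-edge extremality" (`Consts.SingleEdgeExtremal`, OPEN) says the single-pair value
`p⋆ = [P(o ∈ C_x ∪ C_v | x ↮ Y, v ↮ Y) − P(o ∈ C_x | x ↮ Y)] / P(v ∉ C_x | x ↮ Y)` is admissible.  In terms of increasing EVENTS `U` of the
cluster, the two "pure" positions of `U` relative to `B = {v ∈ C_x}` are `U ⊆ B` (proved in `…ConstsSingleEdgeVClass`) and `U ⊇ B`; this file proves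
the latter, in functional form:

* `Consts.singleEdge_margin_nonneg_of_saturated` — **THEOREM.**  For every finite weighted graph, owner `x ∉ Y`, observers `o` and `v ≠ x`, avoided
  set `Y`, and every monotone `f` that is CONSTANT (`= m`) on the clusters containing `v` and `≤ m` everywhere (e.g. `f = 1{C_x meets T}` for any
  target set `T ∋ v`, or `max(1{v ∈ C_x}, g)` for monotone `g ≤ 1`): `covD(f, v) · R ≤ covD(f, o) · M` with
  `M = μ(D₁) μ(D ∩ {x ↮ v})`, `R = μ(D) μ(D₁ ∩ O) − μ(D₁) μ(D ∩ {x ↔ o})` (`D = {x ↮ Y}`, `D₁ = D ∩ {v ↮ Y}`, `O = {x ↔ o} ∪ {v ↔ o}`) — the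
  margin at `λ = p⋆` is nonnegative.
  Proof: with `g = m − f ≥ 0` (antitone, vanishing on `{v ∈ C_x}`) the claim reads `J · μ(D₁∩{x↔v}) · μ(D₁∩O) + μ(D₁) μ(D∩{x↮v}) ∫_{D∩{x↔o}} g ≤
  J · μ(D₁) · μ(D ∩ {x ↔ o})` (`J = ∫_D g`), which is the sum of van den Berg–Häggström–Kahn Thm 1.3 in the increasing/decreasing form given
  `x ↮ Y ∪ {v}` (`1{x↔o}` vs `g`) and Thm 1.3 with vertex sets given `{x,v} ↮ Y` (`1{x↔v}` vs `1{o ∈ C_x ∪ C_v}`).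
[cite: VandenbergHaggstromKahn2005, Thm. 1.3 (p. 6, both sentences) with Remark 1 after Thm. 1.2 (p. 5)]
-/

noncomputable section

namespace Summit.CriticalPhenomena.PercolationContinuityZ3.Theorems

open MeasureTheory Set Literature.Probability.LatticeModels Literature.Probability.Percolation
open scoped Classical

namespace Consts

variable {V : Type*} [Fintype V]

/-- **THEOREM (single-edge extremality against competitors saturated on `{v ∈ C_x}`).**  `μ = prodBernoulli w`; owner `x ∉ Y`, `v ≠ x`;
`f` monotone with `f(C) = m` whenever some pair of `C` contains `v` and `f ≤ m`.  Then, with `D = {x ↮ Y}`, `D₁ = {x ↮ Y} ∩ {v ↮ Y}`,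
`O = {x ↔ o} ∪ {v ↔ o}`:  `covD(f, v) · [μ(D) μ(D₁ ∩ O) − μ(D₁) μ(D ∩ {x ↔ o})] ≤ covD(f, o) · [μ(D₁) μ(D ∩ {x ↮ v})]`.
[cite: VandenbergHaggstromKahn2005, Thm. 1.3 (p. 6) with Remark 1 after Thm. 1.2 (p. 5)] -/
theorem singleEdge_margin_nonneg_of_saturated (w : Sym2 V → unitInterval) (x o v : V) (Y : Set V) (hx : x ∉ Y) (hxv : x ≠ v)
    (f : Set (Sym2 V) → ℝ) (hf : Monotone f) (m : ℝ) (hsat : ∀ C : Set (Sym2 V), (∃ d ∈ C, v ∈ d) → f C = m)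
    (hle : ∀ C : Set (Sym2 V), f C ≤ m) :
    CSH.covD w x Y f v *
        ((prodBernoulli w).real {ω : BondConfig V | ∀ y ∈ Y, ¬ (openGraph ω).Reachable x y} *
            (prodBernoulli w).real
              ({ω : BondConfig V | ∀ y ∈ Y, ¬ (openGraph ω).Reachable x y ∧ ¬ (openGraph ω).Reachable v y} ∩
                (openConn x o ∪ openConn v o)) -
          (prodBernoulli w).real
              {ω : BondConfig V | ∀ y ∈ Y, ¬ (openGraph ω).Reachable x y ∧ ¬ (openGraph ω).Reachable v y} *
            (prodBernoulli w).real ({ω : BondConfig V | ∀ y ∈ Y, ¬ (openGraph ω).Reachable x y} ∩ openConn x o)) ≤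
      CSH.covD w x Y f o *
        ((prodBernoulli w).real
            {ω : BondConfig V | ∀ y ∈ Y, ¬ (openGraph ω).Reachable x y ∧ ¬ (openGraph ω).Reachable v y} *
          (prodBernoulli w).real
            ({ω : BondConfig V | ∀ y ∈ Y, ¬ (openGraph ω).Reachable x y} ∩ {ω | ¬ (openGraph ω).Reachable x v})) := by
  classical
  set μ := prodBernoulli w with hμ
  have hmeas : ∀ U : Set (BondConfig V), MeasurableSet U := fun _ => MeasurableSet.of_discrete
  set D : Set (BondConfig V) := {ω | ∀ y ∈ Y, ¬ (openGraph ω).Reachable x y} with hD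
  set D₁ : Set (BondConfig V) := {ω | ∀ y ∈ Y, ¬ (openGraph ω).Reachable x y ∧ ¬ (openGraph ω).Reachable v y} with hD₁
  set N : Set (BondConfig V) := {ω | ¬ (openGraph ω).Reachable x v} with hN
  set H : Set (BondConfig V) := openConn x v with hH
  set A : Set (BondConfig V) := openConn x o with hA
  set W : Set (BondConfig V) := openConn v o with hW
  set D' : Set (BondConfig V) := {ω | ∀ t ∈ insert v Y, ¬ (openGraph ω).Reachable x t} with hD'
  -- the antitone functional `g = m − f`, vanishing on clusters containing `v`
  set gC : Set (Sym2 V) → ℝ := fun C => m - f C with hgC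
  set g : BondConfig V → ℝ := fun ω => m - f (openEdgeCluster ω x) with hg
  have hgC_anti : Antitone gC := fun C C' hCC' => by simp only [hgC]; linarith [hf hCC']
  have hg_zero : ∀ ω : BondConfig V, (openGraph ω).Reachable x v → g ω = 0 := by
    intro ω hr
    have : f (openEdgeCluster ω x) = m := by
      refine hsat _ ?_
      rcases (reachable_iff_exists_mem_openEdgeCluster ω x v).1 hr with h | ⟨e, he, hve⟩
      · exact absurd h.symm hxv
      · exact ⟨e, he, hve⟩
    simp only [hg, this, sub_self]
  -- set identities
  have s2 : D ∩ N = D' := by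
    ext ω
    simp only [hD, hN, hD', mem_inter_iff, mem_setOf_eq, mem_insert_iff, forall_eq_or_imp]
    tauto
  have sDH : D \ H = D ∩ N := Set.ext fun ω => Iff.rfl
  have sD₁H : D₁ \ H = D₁ ∩ N := Set.ext fun ω => Iff.rfl
  have s4 : D ∩ H = D₁ ∩ H := by
    ext ω
    simp only [hD, hD₁, mem_inter_iff, mem_setOf_eq]
    constructor
    · rintro ⟨h, hxv'⟩
      exact ⟨fun y hy => ⟨h y hy, fun hvy => h y hy ((show (openGraph ω).Reachable x v from hxv').trans hvy)⟩, hxv'⟩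
    · rintro ⟨h, hxv'⟩
      exact ⟨fun y hy => (h y hy).1, hxv'⟩
  have sDAH : D ∩ A ∩ H = D₁ ∩ H ∩ A := by rw [inter_right_comm, s4]
  have sDAN : (D ∩ A) \ H = D' ∩ A := by
    rw [← s2]; ext ω; simp only [mem_sdiff, mem_inter_iff]; constructor
    · rintro ⟨⟨hd, ha⟩, hh⟩; exact ⟨⟨hd, hh⟩, ha⟩
    · rintro ⟨⟨hd, hh⟩, ha⟩; exact ⟨⟨hd, ha⟩, hh⟩
  have sD₁HO : D₁ ∩ (H ∩ (A ∪ W)) = D₁ ∩ H ∩ A := by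
    ext ω
    simp only [mem_inter_iff, mem_union]
    constructor
    · rintro ⟨hd, hxv', hxo | hvo⟩
      · exact ⟨⟨hd, hxv'⟩, hxo⟩
      · exact ⟨⟨hd, hxv'⟩, show (openGraph ω).Reachable x o from (show (openGraph ω).Reachable x v from hxv').trans hvo⟩
    · rintro ⟨⟨hd, hxv'⟩, hxo⟩
      exact ⟨hd, hxv', Or.inl hxo⟩
  -- integrals of `g`: `∫_{S} g = ∫_{S ∩ N} g` (g vanishes on `H`)
  have hint_N : ∀ S : Set (BondConfig V), ∫ ω in S, g ω ∂μ = ∫ ω in S ∩ N, g ω ∂μ := by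
    intro S
    rw [← integral_indicator (hmeas S), ← integral_indicator (hmeas _)]
    refine integral_congr_ae (Filter.Eventually.of_forall fun ω => ?_)
    by_cases hr : (openGraph ω).Reachable x v
    · have h0 : g ω = 0 := hg_zero ω hr
      by_cases hS : ω ∈ S
      · rw [indicator_of_mem hS, h0, indicator_of_notMem (fun h => h.2 hr)]
      · rw [indicator_of_notMem hS, indicator_of_notMem (fun h => hS h.1)]
    · by_cases hS : ω ∈ S
      · rw [indicator_of_mem hS, indicator_of_mem (Set.mem_inter hS hr)]
      · rw [indicator_of_notMem hS, indicator_of_notMem (fun h => hS h.1)]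
  -- `covD f u = −(μ(D) ∫_{D∩{x↔u}} g − (∫_D g) μ(D ∩ {x↔u}))`
  have hcov : ∀ u : V, CSH.covD w x Y f u =
      -(μ.real D * (∫ ω in D ∩ openConn x u, g ω ∂μ) - (∫ ω in D, g ω ∂μ) * μ.real (D ∩ openConn x u)) := by
    intro u
    unfold CSH.covD
    have e1 : ∫ ω in D ∩ openConn x u, f (openEdgeCluster ω x) ∂μ =
        m * μ.real (D ∩ openConn x u) - ∫ ω in D ∩ openConn x u, g ω ∂μ := by
      have : ∫ ω in D ∩ openConn x u, g ω ∂μ = m * μ.real (D ∩ openConn x u) - ∫ ω in D ∩ openConn x u, f (openEdgeCluster ω x) ∂μ := by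
        simp only [hg]
        rw [integral_sub (Integrable.of_finite) (Integrable.of_finite), setIntegral_const, smul_eq_mul, mul_comm]
      linarith
    have e2 : ∫ ω in D, f (openEdgeCluster ω x) ∂μ = m * μ.real D - ∫ ω in D, g ω ∂μ := by
      have : ∫ ω in D, g ω ∂μ = m * μ.real D - ∫ ω in D, f (openEdgeCluster ω x) ∂μ := by
        simp only [hg]
        rw [integral_sub (Integrable.of_finite) (Integrable.of_finite), setIntegral_const, smul_eq_mul, mul_comm]
      linarith
    rw [e1, e2]
    ring
  -- masses and integrals
  set h : ℝ := μ.real (D₁ ∩ H) with hh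
  set n : ℝ := μ.real (D ∩ N) with hn
  set n₁ : ℝ := μ.real (D₁ ∩ N) with hn₁
  set αB : ℝ := μ.real (D₁ ∩ H ∩ A) with hαB
  set α₀ : ℝ := μ.real (D' ∩ A) with hα₀
  set mO : ℝ := μ.real (D₁ ∩ (A ∪ W)) with hmO
  set J : ℝ := ∫ ω in D', g ω ∂μ with hJ
  set I₀ : ℝ := ∫ ω in D' ∩ A, g ω ∂μ with hI₀
  have md : μ.real D = h + n := by
    have e := measureReal_inter_add_sdiff (μ := μ) (s := D) (hmeas H)
    rw [s4, sDH] at e; exact e.symm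
  have md₁ : μ.real D₁ = h + n₁ := by
    have e := measureReal_inter_add_sdiff (μ := μ) (s := D₁) (hmeas H)
    rw [sD₁H] at e; exact e.symm
  have mDA : μ.real (D ∩ A) = αB + α₀ := by
    have e := measureReal_inter_add_sdiff (μ := μ) (s := D ∩ A) (hmeas H)
    rw [sDAH, sDAN] at e; exact e.symm
  have mDH : μ.real (D ∩ H) = h := by rw [s4]
  have iD : ∫ ω in D, g ω ∂μ = J := by rw [hint_N D, s2]
  have iDA : ∫ ω in D ∩ A, g ω ∂μ = I₀ := by
    rw [hint_N (D ∩ A), inter_right_comm, s2]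
  have iDH : ∫ ω in D ∩ H, g ω ∂μ = 0 := by
    rw [hint_N (D ∩ H)]
    have : D ∩ H ∩ N = ∅ := by
      ext ω; simp only [mem_inter_iff, mem_empty_iff_false, iff_false, not_and]; exact fun h hN => hN h.2
    rw [this, Measure.restrict_empty, integral_zero_measure]
  -- (i) vdBHK Thm 1.3, increasing/decreasing, given `x ↮ Y ∪ {v}`: `n · I₀ ≤ α₀ · J`
  have h1 : n * I₀ ≤ α₀ * J := by
    have hx' : x ∉ insert v Y := by
      rintro (h | h)
      · exact hxv h
      · exact hx h
    have key := BHK2006_clusterConditionalPositiveAssociation.antitone_right BHK2006_clusterConditionalPositiveAssociation_holds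
      V w x (insert v Y) (connIndicatorFn x o) gC (monotone_connIndicatorFn x o) hgC_anti hx'
    have e1 : ∫ ω in D', connIndicatorFn x o (openEdgeCluster ω x) ∂μ = μ.real (D' ∩ A) := by
      simp_rw [connIndicatorFn_openEdgeCluster]
      exact KNPreFKG.setIntegral_indicator_one_eq μ D' _
    have e2 : ∫ ω in D', connIndicatorFn x o (openEdgeCluster ω x) * gC (openEdgeCluster ω x) ∂μ = ∫ ω in D' ∩ A, g ω ∂μ := by
      simp_rw [connIndicatorFn_openEdgeCluster]
      have hfun : (fun ω : BondConfig V => (openConn x o : Set (BondConfig V)).indicator (1 : BondConfig V → ℝ) ω * gC (openEdgeCluster ω x)) =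
          (openConn x o : Set (BondConfig V)).indicator g := by
        funext ω
        by_cases hω : ω ∈ openConn x o
        · rw [indicator_of_mem hω, indicator_of_mem hω, Pi.one_apply, one_mul]
        · rw [indicator_of_notMem hω, indicator_of_notMem hω, zero_mul]
      rw [hfun, setIntegral_indicator (hmeas _)]
    have e3 : ∫ ω in D', gC (openEdgeCluster ω x) ∂μ = J := rfl
    have en : μ.real D' = n := by rw [← s2]
    rw [e1, e2, e3, en] at key
    -- key : n * I₀ ≤ α₀ * J
    exact key
  -- (ii) vdBHK Thm 1.3 with sets for `{x, v}` given `{x,v} ↮ Y`: `h · mO ≤ (h + n₁) · αB`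
  have h2 : h * mO ≤ (h + n₁) * αB := by
    set F : Set (Sym2 V) → ℝ := fun K => if (openGraph K).Reachable x v then (1 : ℝ) else 0 with hF
    set G : Set (Sym2 V) → ℝ := fun K => if ((openGraph K).Reachable x o ∨ (openGraph K).Reachable v o) then (1 : ℝ) else 0 with hG
    have hFm : Monotone F := TripodExchange.predIndicator_monotone fun K K' hKK' hr => hr.mono (openGraph_mono hKK')
    have hGm : Monotone G := by
      refine TripodExchange.predIndicator_monotone ?_
      rintro K K' hKK' (hr | hr)
      · exact Or.inl (hr.mono (openGraph_mono hKK'))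
      · exact Or.inr (hr.mono (openGraph_mono hKK'))
    have hxS : x ∈ ({x, v} : Set V) := mem_insert x {v}
    have hvS : v ∈ ({x, v} : Set V) := mem_insert_of_mem x rfl
    have hcond : {ω : BondConfig V | ∀ s ∈ ({x, v} : Set V), ∀ t ∈ Y, ¬ (openGraph ω).Reachable s t} = D₁ := by
      ext ω
      simp only [hD₁, mem_setOf_eq, mem_insert_iff, mem_singleton_iff, forall_eq_or_imp, forall_eq]
      exact ⟨fun hh y hy => ⟨hh.1 y hy, hh.2 y hy⟩, fun hh => ⟨fun y hy => (hh y hy).1, fun y hy => (hh y hy).2⟩⟩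
    have hFω : ∀ ω : BondConfig V, F (⋃ s ∈ ({x, v} : Set V), openEdgeCluster ω s) = H.indicator 1 ω := by
      intro ω
      have hiff : (openGraph (⋃ s ∈ ({x, v} : Set V), openEdgeCluster ω s)).Reachable x v ↔ (openGraph ω).Reachable x v :=
        (KNSep.reachable_iff_cluster ω {x, v} hxS v).symm
      simp only [hF, hiff]
      exact TwoSetConditionalAssociation.predIndicator_eq_indicator (fun ω' => (openGraph ω').Reachable x v) ω
    have hGω : ∀ ω : BondConfig V, G (⋃ s ∈ ({x, v} : Set V), openEdgeCluster ω s) = (A ∪ W).indicator 1 ω := by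
      intro ω
      have hiff : ((openGraph (⋃ s ∈ ({x, v} : Set V), openEdgeCluster ω s)).Reachable x o ∨
          (openGraph (⋃ s ∈ ({x, v} : Set V), openEdgeCluster ω s)).Reachable v o) ↔
          ((openGraph ω).Reachable x o ∨ (openGraph ω).Reachable v o) := by
        rw [← KNSep.reachable_iff_cluster ω {x, v} hxS o, ← KNSep.reachable_iff_cluster ω {x, v} hvS o]
      simp only [hG, hiff]
      exact TwoSetConditionalAssociation.predIndicator_eq_indicator (fun ω' => (openGraph ω').Reachable x o ∨ (openGraph ω').Reachable v o) ω
    have key := BHK2006_setClusterConditionalPositiveAssociation w {x, v} Y F G hFm hGm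
    simp only [hcond, hFω, hGω, TripodExchange.setIntegral_indicator_one_eq,
      TripodExchange.setIntegral_indicator_mul_indicator_eq] at key
    rw [sD₁HO, md₁] at key
    -- key : h * mO ≤ (h + n₁) * αB
    exact key
  -- assemble: both covD's in terms of g, then the two inequalities
  rw [hcov v, hcov o, iD, iDA, iDH, mDA, mDH, md, md₁]
  have hJ0 : 0 ≤ J := by
    refine setIntegral_nonneg (hmeas _) fun ω _ => ?_
    simp only [hg]; linarith [hle (openEdgeCluster ω x)]
  have hh0 : 0 ≤ h := measureReal_nonneg
  have hn0 : 0 ≤ n := measureReal_nonneg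
  have hn₁0 : 0 ≤ n₁ := measureReal_nonneg
  have t1 : 0 ≤ (h + n₁) * (α₀ * J - n * I₀) := mul_nonneg (by linarith) (by linarith)
  have t2 : 0 ≤ J * ((h + n₁) * αB - h * mO) := mul_nonneg hJ0 (by linarith)
  nlinarith [t1, t2, mul_nonneg (add_nonneg hh0 hn0) (add_nonneg t1 t2)]

end Consts

end Summit.CriticalPhenomena.PercolationContinuityZ3.Theorems

end
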